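import Literature.NumberTheory.Rogawski1990.UnitFundamentalLemmaSplitPlaceLeviSides
import Literature.NumberTheory.Rogawski1990.UnitFundamentalLemmaSplitPlaceAssembly
import Literature.NumberTheory.Rogawski1990.FinExplicitTransferFactorSplitPlaceTau
import Literature.NumberTheory.Rogawski1990.FinExplicitTransferFactorNondegenerate
import Literature.NumberTheory.Rogawski1990.LocalTransferLinear
import Literature.NumberTheory.Automorphic.CompactCoreCentralizerNonarch
import Literature.NumberTheory.Automorphic.GLnStandardLeviUnimodular
import Literature.NumberTheory.Automorphic.UnitaryGroupPureTensorEulerProduct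
import Literature.NumberTheory.Weil1964.GLnIntegerPointsVolume
import HarnessLib

/-!
# [Rogawski1990 §4.9 Prop. 4.9.1 (b)] The unit fundamental lemma at a place SPLIT in `L`: the per-pair identity
# `Φ([γ_H], 1_{K_H}; mH) = Δ‴_v(γ_H, γ₀) · Φ([γ₀], 1_{K′}; mG)` and the letter's local clause `IsLocalUnitTransfer`
(Rogawski (1990), §4.9 Prop. 4.9.1 (b) p. 55 «`Δ_{G∕H}(γ)Φ^κ(γ, f) = Φ^st(γ, f^H)` where `f` and `f^H` are the units of the Hecke algebras»;
§4.13 Lemma 4.13.1 (a) p. 64; §14.2 p. 232 and §3.1 p. 19: at a split place stable conjugacy is conjugacy and `κ = +1`)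

Topic `NumberTheory/Rogawski1990`; namespaces `Literature.NumberTheory.Automorphic` (§0, generic) and `Literature.NumberTheory.Rogawski1990`
(§1–§3).  THEOREMS ONLY (no definition, no instance, no notation, no named fact, no `sorry`).  Cell `pub/hodgecm-mathlib`, programme P3a,
letter **N7 (#103)** ★ `UnitFundamentalLemmaExplicitClosed`, row «D-N7s-G2» FILE B (LEAD F0P3a-plan T7-39 (B) ∕ T7-53 ∕ T8-11).  Over FILE A
(★ `UnitFundamentalLemmaSplitPlaceLeviSides`: both unit class orbital integrals at a split place are ONE `[0,∞]`-valued Levi orbital integral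
`I_M(p)` for canonical families read at the point), ★ p838654 (`IsLocalUnitTransfer … v ↔` the per-pair identity), ★ D-S2s∕B6
(`Δ‴_v(γ_H, γ₀) = μ_w(det g_w) · D_{G∕H,v}(γ_H)` under the conjugate-self-duality guard `μᶜ = μ⁻¹`), ★ D-S2r (`D_{G∕H,v} = ‖det(1 − K_p)‖ ·
‖det K_p‖^{−1∕2}`) and ★ B4″ (the block data of `p = diag(g_w, u_w)`):

* §0 generic: `exists_conj_apply_mem_of_lintegral_descConj_indicator_ne_zero` (a non-zero orbital integral of an indicator has a point in
  its support), `valued_eq_one_of_normAbs_eq_one` (`‖u‖_w = 1 ⇒ |u|_w = 1` on `L_w`, the two valuations being equivalent).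
* §1 the LEVI SIDE of the scalar identity: `exists_levi_canonical_measures` (THE canonical pair `(ν_M, t_M)` exists), `normAbs_det_boxAd_eq_one_of_conj_mem_glInt`
  (`‖det K_p‖ = 1` as soon as an `M`-conjugate of `p` is integral), `normAbs_det_fst_eq_one_of_conj_mem_glInt` (then `‖det g_w‖ = 1`),
  `finTau_eq_one_of_isUnramifiedAt` (`τ_v(γ_H) = μ_w(det g_w) = 1` for `μ` UNRAMIFIED at `w`).
* §2 **`classOrbitalIntegral_unit_eq_finExplicitDelta_mul_of_split`** — THE PER-PAIR IDENTITY: at a place `v` of `L⁺` split in `L` (`w ∣ v`, `c • w ≠ w`),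
  with `H′` hermitian, invertible and `w`-unimodular (`H′_w ∈ GL₃(𝒪_w)`), `μᶜ = μ⁻¹` and `μ` unramified at `w`, for CANONICAL `mH`, `mG` (levels of mass one)
  and every `G`-regular `γ_H ∈ H_v`, every match `γ₀ ∈ U(H′)_v`:
  `Φ([γ_H], 1_{K_H}; mH) = Δ‴_v(γ_H, γ₀) · Φ([γ₀], 1_{K′}; mG)` — off the support both sides vanish; on it `‖det K_p‖ = 1` and `μ_w(det g_w) = 1`, so
  `Δ‴_v · ‖det(1 − K_p)‖⁻¹ ‖det K_p‖ = μ_w(det g_w) · ‖det(1 − K_p)‖ ‖det K_p‖^{−1∕2} · ‖det(1 − K_p)‖⁻¹ ‖det K_p‖ = 1`.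
* §3 **`isLocalUnitTransfer_finExplicitCollection_of_split`** — the letter's local clause ★ `IsLocalUnitTransfer L H′ v (finExplicitCollection L H′ μ hl hr v) mH mG`
  AT A SPLIT PLACE under the per-place guards `{hw, hH′i, hμ, ν_G(K′) = ν_H(K_H) = 1}` (★ p838654) — the split half of N7's
  `∃ Sbad, ∀ v ∉ Sbad, …` (`Sbad ⊇` the places where `μ` ramifies or `H′` is not `w`-unimodular, both finite); the non-split half is [BlasiusRogawski1992].
HONEST LABEL: HC_CM is proved only modulo the printed citations (2 remaining named inputs hLiu418, h413) until rung 0 closes; this file proves the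
SPLIT-PLACE instances of ONE of them (N7) and nothing at non-split places.

## References
* [Rogawski1990] J. D. Rogawski, *Automorphic Representations of Unitary Groups in Three Variables*, Ann. of Math. Stud. 123 (1990), §4.9
  Prop. 4.9.1 (b) p. 55; §4.13 Lemma 4.13.1 (a) p. 64; §4.3 (4.3.1) p. 43; §14.2 p. 232; §3.1 p. 19.
* [DeitmarEchterhoff2014] A. Deitmar, S. Echterhoff, *Principles of Harmonic Analysis*, 2nd ed. (2014), Thm. 1.5.3.
* [TateThesis1967] J. Tate, *Fourier analysis in number fields and Hecke's zeta-functions* (1967), §2.5.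
* [WeilBNT1967] A. Weil, *Basic Number Theory* (1967), Ch. I §4.
* [BlasiusRogawski1992] D. Blasius, J. D. Rogawski, *Fundamental lemmas for `U(3)` and related groups* (1992), Thm. 1 (the non-split half, not used here).
-/

set_option autoImplicit false

noncomputable section

open MeasureTheory Measure Set NumberField IsDedekindDomain Literature.MeasureTheory.Group
open scoped ENNReal NNReal Matrix MatrixGroups

namespace Literature.NumberTheory.Automorphic

/-! ## §0 Generic plumbing -/

section Support

variable {A B : Type*} [Group A] (γ : A) {S : Subgroup A} (hS : ∀ s ∈ S, s * γ = γ * s) [MeasurableSpace (A ⧸ S)]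
  (m : Measure (A ⧸ S))

/-- **A non-zero orbital integral of an indicator has a point in its support**: if `∫⁻ 1_K(F(y γ y⁻¹)) dm(y) ≠ 0` then some conjugate
`a γ a⁻¹` has `F(a γ a⁻¹) ∈ K` (otherwise the integrand vanishes identically). [cite: Rogawski1990, §4.9 p. 54] -/
theorem exists_conj_apply_mem_of_lintegral_descConj_indicator_ne_zero (F : A → B) (K : Set B)
    (h : ∫⁻ y, descConj γ S hS (fun a => K.indicator (fun _ => (1 : ℝ≥0∞)) (F a)) y ∂m ≠ 0) :
    ∃ a : A, F (a * γ * a⁻¹) ∈ K := by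
  by_contra hne
  refine h ?_
  have h0 : ∀ y, descConj γ S hS (fun a => K.indicator (fun _ => (1 : ℝ≥0∞)) (F a)) y = 0 := fun y => by
    induction y using QuotientGroup.induction_on with
    | H a => rw [descConj_mk]; exact Set.indicator_of_notMem (fun hK => hne ⟨a, hK⟩) _
  rw [lintegral_congr h0, lintegral_zero]

end Support

section ValuedBridge

open ValuativeRel Literature.NumberTheory.GaloisRepresentations.IsNonarchimedeanLocalField

variable {K : Type} [Field K] [NumberField K] (u : HeightOneSpectrum (𝓞 K))

/-- Mathlib's norm on `K_u` is the normalised absolute value `normAbs` (both are `q_u^{-u(x)}`; ★ `norm_eq_coe_normAbs` of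
`GlobalHeckeTheoryGL2OfCenterInvariant`, reproduced to keep the import closure small). [folklore] -/
private theorem norm_eq_coe_normAbs' (x : u.adicCompletion K) : ‖x‖ = ((normAbs (u.adicCompletion K) x : ℝ≥0) : ℝ) := by
  by_cases hx : x = 0
  · rw [hx, norm_zero, map_zero, NNReal.coe_zero]
  have hv : Valued.v x ≠ 0 := (Valuation.ne_zero_iff _).2 hx
  have hxn : Valued.v x = WithZero.exp (Multiplicative.toAdd (WithZero.unzero hv)) := by
    rw [WithZero.exp, ofAdd_toAdd, WithZero.coe_unzero]
  rw [FinitePlace.norm_def, WithZeroMulInt.toNNReal_neg_apply _ hv,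
    normAbs_eq_inv_zpow_of_valued_eq u hxn, residueFieldCard_adicCompletion_eq, _root_.inv_zpow', neg_neg]
  rfl

/-- `‖x‖_u ≤ 1 ⇒ |x|_u ≤ 1`: the valuation ring of the `ValuativeRel` structure of `K_u` (★ `normAbs_le_one_iff`) is Mathlib's `Valued` one
(the two valuations are equivalent, `ValuativeRel.isEquiv`). [cite: WeilBNT1967, Ch. I §4] -/
theorem valued_le_one_of_normAbs_le_one {x : u.adicCompletion K} (h : normAbs (u.adicCompletion K) x ≤ 1) : Valued.v x ≤ 1 := by
  have hx : x ∈ 𝒪[u.adicCompletion K] := normAbs_le_one_iff.1 h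
  rw [Valuation.mem_integer_iff] at hx
  exact ((ValuativeRel.isEquiv (valuation (u.adicCompletion K)) (Valued.v : Valuation (u.adicCompletion K) _)).le_one_iff_le_one).1 hx

/-- **`‖z‖_u = 1 ⇒ |z|_u = 1`** for a unit `z` of `K_u` (apply the previous lemma to `z` and `z⁻¹`). [cite: WeilBNT1967, Ch. I §4] -/
theorem valued_eq_one_of_normAbs_eq_one (z : (u.adicCompletion K)ˣ) (h : normAbs (u.adicCompletion K) (z : u.adicCompletion K) = 1) :
    Valued.v (z : u.adicCompletion K) = 1 := by
  have h1 : Valued.v (z : u.adicCompletion K) ≤ 1 := valued_le_one_of_normAbs_le_one u h.le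
  have h2 : Valued.v ((z⁻¹ : (u.adicCompletion K)ˣ) : u.adicCompletion K) ≤ 1 := by
    refine valued_le_one_of_normAbs_le_one u (le_of_eq ?_)
    rw [Units.val_inv_eq_inv_val, map_inv₀, h, inv_one]
  rw [Units.val_inv_eq_inv_val, map_inv₀] at h2
  have hne : Valued.v (z : u.adicCompletion K) ≠ 0 := (Valuation.ne_zero_iff _).2 z.ne_zero
  exact le_antisymm h1 (by rwa [inv_le_one₀ (zero_lt_iff.2 hne)] at h2)

end ValuedBridge

end Literature.NumberTheory.Automorphic

namespace Literature.NumberTheory.Rogawski1990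

open Literature.NumberTheory.Automorphic Literature.NumberTheory.Automorphic.UnitaryGroup
open Literature.NumberTheory.GaloisRepresentations Literature.NumberTheory.GaloisRepresentations.IsNonarchimedeanLocalField

/-! ## §1 The Levi side of the scalar identity -/

section Levi

variable {L : Type} [Field L] [NumberField L] {v : HeightOneSpectrum (𝓞 ↥(maximalRealSubfield L))} (w : UnitaryGroup.PlacesOver L v)
  (g : GL (Fin 2) (w.1.adicCompletion L)) (u : GL (Fin 1) (w.1.adicCompletion L))
  (p : standardParabolicGL (w.1.adicCompletion L) (fun i : Fin 3 => decide (2 ≤ (i : ℕ))))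
  (hp : (p : GL (Fin 3) (w.1.adicCompletion L)) = UnitaryGroup.reindexGL finSumFinEquiv (UnitaryGroup.blockDiagGL (g, u)))
  (hpM : (p : GL (Fin 3) (w.1.adicCompletion L)) ∈ standardLeviGL (w.1.adicCompletion L) (fun i : Fin 3 => decide (2 ≤ (i : ℕ))))

include hp in
/-- **THE canonical pair `(ν_M, t_M)` exists**: a Haar measure `ν_M` on `M = M_{(2,1)}(L_w)` — right invariant and inversion invariant, `M` being
unimodular (★ `isMulRightInvariant_haar_standardLeviGL`, ★ `isInvInvariant_haar_standardLeviGL`) — with `ν_M(M ∩ GL₃(𝒪_w)) = 1`, and on the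
centraliser `C(p) ⊓ M` of a regular semisimple `p = diag(g, u)` a Haar, inversion-invariant `t_M` with mass one on the compact core (★
`exists_isHaarMeasure_compactCore_centralizer_eq_one`, transported along `C(p) ≅ C(p) ⊓ M`). [cite: Rogawski1990, §4.3 (4.3.1) p. 43; §4.9 p. 54]
[cite: DeitmarEchterhoff2014, Thm. 1.5.3] -/
theorem exists_levi_canonical_measures [MeasurableSpace (GL (Fin 3) (w.1.adicCompletion L))] [BorelSpace (GL (Fin 3) (w.1.adicCompletion L))]
    [LocallyCompactSpace (GL (Fin 3) (w.1.adicCompletion L))]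
    (hreg : IsRegularElt (UnitaryGroup.reindexGL finSumFinEquiv (UnitaryGroup.blockDiagGL (g, u)))) :
    ∃ (νM : Measure ↥(standardLeviGL (w.1.adicCompletion L) (fun i : Fin 3 => decide (2 ≤ (i : ℕ))))) (_ : νM.IsHaarMeasure) (_ : νM.IsMulRightInvariant) (_ : νM.IsInvInvariant)
      (tM : Measure ↥((Subgroup.centralizer ({(p : GL (Fin 3) (w.1.adicCompletion L))} : Set (GL (Fin 3) (w.1.adicCompletion L)))).subgroupOf
      (standardLeviGL (w.1.adicCompletion L) (fun i : Fin 3 => decide (2 ≤ (i : ℕ))))))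
      (_ : tM.IsHaarMeasure) (_ : tM.IsInvInvariant),
      νM (Subtype.val ⁻¹' (glInt 3 (w.1.adicCompletion L) : Set (GL (Fin 3) (w.1.adicCompletion L)))) = 1 ∧ tM (compactCore _) = 1 := by
  have hMc : IsClosed ((standardLeviGL (w.1.adicCompletion L) (fun i : Fin 3 => decide (2 ≤ (i : ℕ))) : Subgroup (GL (Fin 3) (w.1.adicCompletion L))) : Set (GL (Fin 3) (w.1.adicCompletion L))) := isClosed_standardLeviGL (R := (w.1.adicCompletion L)) _
  have hMK : IsCompact (Subtype.val ⁻¹' (glInt 3 (w.1.adicCompletion L) : Set (GL (Fin 3) (w.1.adicCompletion L))) : Set ↥(standardLeviGL (w.1.adicCompletion L) (fun i : Fin 3 => decide (2 ≤ (i : ℕ))))) :=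
    hMc.isClosedEmbedding_subtypeVal.isCompact_preimage (isCompact_glInt 3 (w.1.adicCompletion L))
  have hMo : IsOpen (Subtype.val ⁻¹' (glInt 3 (w.1.adicCompletion L) : Set (GL (Fin 3) (w.1.adicCompletion L))) : Set ↥(standardLeviGL (w.1.adicCompletion L) (fun i : Fin 3 => decide (2 ≤ (i : ℕ))))) :=
    (isOpen_glInt 3 (w.1.adicCompletion L)).preimage continuous_subtype_val
  haveI : LocallyCompactSpace ↥(standardLeviGL (w.1.adicCompletion L) (fun i : Fin 3 => decide (2 ≤ (i : ℕ)))) := hMc.isClosedEmbedding_subtypeVal.locallyCompactSpace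
  haveI : BorelSpace ↥(standardLeviGL (w.1.adicCompletion L) (fun i : Fin 3 => decide (2 ≤ (i : ℕ)))) := Subtype.borelSpace _
  have hνex := exists_isHaarMeasure_apply_eq_one hMK (by rw [hMo.interior_eq]; exact ⟨1, (glInt 3 (w.1.adicCompletion L)).one_mem⟩)
  obtain ⟨νM, hνH, hνM⟩ := hνex
  haveI := hνH
  haveI : νM.IsMulRightInvariant := isMulRightInvariant_haar_standardLeviGL (w.1.adicCompletion L) _ νM
  haveI : νM.IsInvInvariant := isInvInvariant_haar_standardLeviGL (w.1.adicCompletion L) _ νM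
  -- the centraliser measure: on `C(p) ≤ GL₃(L_w)` by ★ `exists_isHaarMeasure_compactCore_centralizer_eq_one`, transported to `C(p) ⊓ M`
  have hdet := det_sub_ne_zero_of_isRegularElt_reindexGL_blockDiagGL 2 finSumFinEquiv g u hreg
  have hTM : Subgroup.centralizer ({(p : GL (Fin 3) (w.1.adicCompletion L))} : Set (GL (Fin 3) (w.1.adicCompletion L))) ≤
      standardLeviGL (w.1.adicCompletion L) (fun i : Fin 3 => decide (2 ≤ (i : ℕ))) := by
    rw [hp]; exact centralizer_le_standardLeviGL_of_det_sub_ne_zero 2 g u hdet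
  have hsep : (((p : GL (Fin 3) (w.1.adicCompletion L)) : Matrix (Fin 3) (Fin 3) (w.1.adicCompletion L)).charpoly).Separable := by
    have h := hreg; rw [← hp] at h; exact h
  haveI : BorelSpace ↥(Subgroup.centralizer ({(p : GL (Fin 3) (w.1.adicCompletion L))} : Set (GL (Fin 3) (w.1.adicCompletion L)))) := Subtype.borelSpace _
  haveI : BorelSpace ↥((Subgroup.centralizer ({(p : GL (Fin 3) (w.1.adicCompletion L))} : Set (GL (Fin 3) (w.1.adicCompletion L)))).subgroupOf
      (standardLeviGL (w.1.adicCompletion L) (fun i : Fin 3 => decide (2 ≤ (i : ℕ))))) := Subtype.borelSpace _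
  have htex := exists_isHaarMeasure_compactCore_centralizer_eq_one w.1 (p : GL (Fin 3) (w.1.adicCompletion L)) hsep
  obtain ⟨t, htH, hti, ht1⟩ := htex
  haveI := htH
  haveI := hti
  haveI : (Measure.map (Subgroup.subgroupOfEquivOfLe hTM).symm t).IsHaarMeasure :=
    MulEquiv.isHaarMeasure_map t _ (continuous_subgroupOfEquivOfLe_symm _ _ hTM) (continuous_subgroupOfEquivOfLe _ _ hTM)
  haveI : (Measure.map (Subgroup.subgroupOfEquivOfLe hTM).symm t).IsInvInvariant :=
    isInvInvariant_map_mulEquiv _ (continuous_subgroupOfEquivOfLe_symm _ _ hTM).measurable t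
  let fs : ↥(Subgroup.centralizer ({(p : GL (Fin 3) (w.1.adicCompletion L))} : Set (GL (Fin 3) (w.1.adicCompletion L)))) ≃ₜ
      ↥((Subgroup.centralizer ({(p : GL (Fin 3) (w.1.adicCompletion L))} : Set (GL (Fin 3) (w.1.adicCompletion L)))).subgroupOf
      (standardLeviGL (w.1.adicCompletion L) (fun i : Fin 3 => decide (2 ≤ (i : ℕ))))) :=
    { toEquiv := (Subgroup.subgroupOfEquivOfLe hTM).symm.toEquiv
      continuous_toFun := continuous_subgroupOfEquivOfLe_symm _ _ hTM
      continuous_invFun := continuous_subgroupOfEquivOfLe _ _ hTM }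
  have hfs : (⇑fs : _ → _) = ⇑(Subgroup.subgroupOfEquivOfLe hTM).symm := rfl
  have hs1 : (Measure.map (Subgroup.subgroupOfEquivOfLe hTM).symm t) (compactCore _) = 1 := by
    rw [← hfs]
    exact map_apply_compactCore_eq_one_of_homeomorph fs (fun a b => rfl) t ht1
  exact ⟨νM, inferInstance, inferInstance, inferInstance, _, inferInstance, inferInstance, hνM, hs1⟩

/-- **`‖det K_p‖_w = 1` as soon as an `M`-conjugate of `p` is integral** (`K_{m p m⁻¹}` and `K_p` have the same determinant, ★ `det_boxAd_conj_eq`;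
★ `normAbs_det_boxAd_eq_one_of_mem_glInt`): the factor `δ_P(p)^{1∕2}` of the descent is `1` on the support of `1_{K_M}`.
[cite: Rogawski1990, §4.13 Lemma 4.13.1 (a) p. 64] -/
theorem normAbs_det_boxAd_eq_one_of_conj_mem_glInt (m₀ : ↥(standardLeviGL (w.1.adicCompletion L) (fun i : Fin 3 => decide (2 ≤ (i : ℕ)))))
    (hm₀ : ((m₀ * ⟨(p : GL (Fin 3) (w.1.adicCompletion L)), hpM⟩ * m₀⁻¹ : ↥(standardLeviGL (w.1.adicCompletion L) (fun i : Fin 3 => decide (2 ≤ (i : ℕ))))) : GL (Fin 3) (w.1.adicCompletion L)) ∈ glInt 3 (w.1.adicCompletion L)) :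
    normAbs (w.1.adicCompletion L) (Matrix.of
            fun q q' : {i : Fin 3 // decide (2 ≤ (i : ℕ)) = false} × {j : Fin 3 // decide (2 ≤ (j : ℕ)) = true} =>
              ((p : GL (Fin 3) (w.1.adicCompletion L)) : Matrix (Fin 3) (Fin 3) (w.1.adicCompletion L)) q.1 q'.1 *
                (((p⁻¹ : standardParabolicGL (w.1.adicCompletion L) (fun i : Fin 3 => decide (2 ≤ (i : ℕ)))) :
                  GL (Fin 3) (w.1.adicCompletion L)) : Matrix (Fin 3) (Fin 3) (w.1.adicCompletion L)) q'.2 q.2).det = 1 := by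
  let mP : standardParabolicGL (w.1.adicCompletion L) (fun i : Fin 3 => decide (2 ≤ (i : ℕ))) :=
    ⟨(m₀ : GL (Fin 3) (w.1.adicCompletion L)), standardLeviGL_le (w.1.adicCompletion L) _ m₀.2⟩
  have hmem : ((mP * p * mP⁻¹ : standardParabolicGL (w.1.adicCompletion L) (fun i : Fin 3 => decide (2 ≤ (i : ℕ)))) : GL (Fin 3) (w.1.adicCompletion L)) ∈ glInt 3 (w.1.adicCompletion L) := hm₀
  rw [← det_boxAd_conj_eq mP p]
  exact normAbs_det_boxAd_eq_one_of_mem_glInt (mP * p * mP⁻¹) hmem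

include u hp in
/-- **`‖det g‖_w = 1` as soon as an `M`-conjugate of `p = diag(g, u)` is integral**: in the model `M ≅ GL₂ × GL₁` (★
`exists_continuousMulEquiv_prod_standardLeviGL_twoBlock`) the conjugate is `diag(y₁ g y₁⁻¹, y₂ u y₂⁻¹)`, integral iff both blocks are (★
`reindexGL_finSumFinEquiv_blockDiagGL_mem_glInt_iff`), and `det(y₁ g y₁⁻¹) = det g` is then a unit (★ `mem_glInt_iff_forall_mem_integer_and_normAbs_det_eq_one`).
[cite: Rogawski1990, §4.9 p. 55; §4.13 p. 64] [cite: WeilBNT1967, Ch. I §4] -/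
theorem normAbs_det_fst_eq_one_of_conj_mem_glInt (m₀ : ↥(standardLeviGL (w.1.adicCompletion L) (fun i : Fin 3 => decide (2 ≤ (i : ℕ)))))
    (hm₀ : ((m₀ * ⟨(p : GL (Fin 3) (w.1.adicCompletion L)), hpM⟩ * m₀⁻¹ : ↥(standardLeviGL (w.1.adicCompletion L) (fun i : Fin 3 => decide (2 ≤ (i : ℕ))))) : GL (Fin 3) (w.1.adicCompletion L)) ∈ glInt 3 (w.1.adicCompletion L)) :
    normAbs (w.1.adicCompletion L) ((g : Matrix (Fin 2) (Fin 2) (w.1.adicCompletion L)).det) = 1 := by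
  obtain ⟨eM, heM⟩ : ∃ eM : (GL (Fin 2) (w.1.adicCompletion L) × GL (Fin 1) (w.1.adicCompletion L)) ≃ₜ* ↥(standardLeviGL (w.1.adicCompletion L) (fun i : Fin 3 => decide (2 ≤ (i : ℕ)))),
      ∀ x, ((eM x : ↥(standardLeviGL (w.1.adicCompletion L) (fun i : Fin 3 => decide (2 ≤ (i : ℕ))))) : GL (Fin 3) (w.1.adicCompletion L)) = UnitaryGroup.reindexGL finSumFinEquiv (UnitaryGroup.blockDiagGL x) :=
    exists_continuousMulEquiv_prod_standardLeviGL_twoBlock (w.1.adicCompletion L) 2 1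
  have hpe : (⟨(p : GL (Fin 3) (w.1.adicCompletion L)), hpM⟩ : ↥(standardLeviGL (w.1.adicCompletion L) (fun i : Fin 3 => decide (2 ≤ (i : ℕ))))) = eM (g, u) := Subtype.ext (by rw [heM, hp])
  set y := eM.symm m₀ with hy
  have hm : m₀ = eM y := (eM.apply_symm_apply m₀).symm
  have hconj : ((m₀ * ⟨(p : GL (Fin 3) (w.1.adicCompletion L)), hpM⟩ * m₀⁻¹ : ↥(standardLeviGL (w.1.adicCompletion L) (fun i : Fin 3 => decide (2 ≤ (i : ℕ))))) : GL (Fin 3) (w.1.adicCompletion L)) =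
      UnitaryGroup.reindexGL finSumFinEquiv (UnitaryGroup.blockDiagGL (y * (g, u) * y⁻¹)) := by
    rw [hm, hpe, ← map_mul, ← map_inv, ← map_mul, heM]
  rw [hconj] at hm₀
  have h1 := ((reindexGL_finSumFinEquiv_blockDiagGL_mem_glInt_iff (k := 2) (l := 1) (y * (g, u) * y⁻¹)).1 hm₀).1
  rw [Prod.fst_mul, Prod.fst_mul, Prod.fst_inv] at h1
  have h2 := ((Weil1964.mem_glInt_iff_forall_mem_integer_and_normAbs_det_eq_one _).1 h1).2
  have hdet : ((y.1 * g * y.1⁻¹ : GL (Fin 2) (w.1.adicCompletion L)) : Matrix (Fin 2) (Fin 2) (w.1.adicCompletion L)).det = (g : Matrix (Fin 2) (Fin 2) (w.1.adicCompletion L)).det := by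
    rw [← Matrix.GeneralLinearGroup.val_det_apply, ← Matrix.GeneralLinearGroup.val_det_apply, map_mul, map_mul, map_inv,
      mul_comm (Matrix.GeneralLinearGroup.det y.1), mul_assoc, mul_inv_cancel, mul_one]
  rwa [hdet] at h2

end Levi

section Tau

variable (L : Type) [Field L] [NumberField L] [IsCMField L] (v : HeightOneSpectrum (𝓞 ↥(maximalRealSubfield L)))
  (a : ((UnitaryGroup.cmDatum L 2 (Matrix.of fun i j : Fin 2 => if i.val + j.val + 1 = 2 then (1 : L) else 0)).Local v ×
      (UnitaryGroup.cmDatum L 1 (Matrix.of fun i j : Fin 1 => if i.val + j.val + 1 = 1 then (1 : L) else 0)).Local v))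
  (w : UnitaryGroup.PlacesOver L v) (μ : HeckeCharacter L)

/-- **`τ_v(γ_H) = 1` for `μ` UNRAMIFIED at `w` when `det g_w` is a `w`-adic unit**: at a split place under the guard `μᶜ = μ⁻¹`,
`τ_v(γ_H) = μ_w(det g_w)` (★ B6 `finTau_eq_localComponent_det_of_split`), and an unramified local component kills the units (★
`HeckeCharacter.IsUnramifiedAt.map_localUnits_eq_one`). [cite: Rogawski1990, §4.9 p. 55] [cite: TateThesis1967, §2.5] -/
theorem finTau_eq_one_of_isUnramifiedAt (hw : IsCMField.complexConj L • w.1 ≠ w.1)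
    (hdual : HeckeCharacter.galConj (IsCMField.complexConj L) μ = μ⁻¹) (hμ : μ.IsUnramifiedAt w.1)
    (hu : IsUnit ((finCharpolyTwo L v a).eval (finGammaTwo L v a)))
    (hdet : Valued.v (((isUnit_det_fst_map_apply L v a w).unit : ((w.1.adicCompletion L))ˣ) : (w.1.adicCompletion L)) = 1) :
    finTau L v a μ = 1 := by
  rw [finTau_eq_localComponent_det_of_split L v a w μ hw hdual hu, HeckeCharacter.localComponent_apply,
    hμ.map_localUnits_eq_one _ hdet, Units.val_one]

end Tau

/-! ## §2 The per-pair identity -/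

section Scalar

variable {K : Type} [Field K] [NumberField K] (u : HeightOneSpectrum (𝓞 K))

/-- **The scalar bookkeeping of the unit identity** at a split place, as an identity of complex numbers: with `I` the common Levi orbital
integral, `x = det(1 − K_p) ≠ 0`, `y = det K_p`, `τ = τ_v(γ_H)`, and the SUPPORT RULE «`I ≠ 0 ⇒ ‖y‖ = 1 ∧ τ = 1`»:
`I = τ · (‖x‖ · ‖y‖^{−1∕2}) · ((‖x⁻¹‖ · ‖y‖) · I)` (real parts; `Δ‴_v = τ_v · D_{G∕H,v}`, `D_{G∕H,v} = ‖det(1 − K_p)‖ ‖det K_p‖^{−1∕2}` against the Jacobian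
`‖det(1 − K_p)‖⁻¹ ‖det K_p‖` of Lemma 4.13.1 (a)). [cite: Rogawski1990, §4.9 Prop. 4.9.1 (b) p. 55; §4.13 Lemma 4.13.1 (a) p. 64] -/
theorem unit_scalar_identity (x y : u.adicCompletion K) (hx : x ≠ 0) (I : ℝ≥0∞) (τ : ℂ)
    (hsupp : I ≠ 0 → normAbs (u.adicCompletion K) y = 1 ∧ τ = 1) :
    ((I.toReal : ℝ) : ℂ) =
      τ * ((‖x‖ * (Real.sqrt ‖y‖)⁻¹ : ℝ) : ℂ) *
        (((((normAbs (u.adicCompletion K) x⁻¹ * normAbs (u.adicCompletion K) y : ℝ≥0) : ℝ≥0∞) * I).toReal : ℝ) : ℂ) := by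
  by_cases hI : I = 0
  · rw [hI, mul_zero, ENNReal.toReal_zero, Complex.ofReal_zero, mul_zero]
  obtain ⟨hy, hτ⟩ := hsupp hI
  have hxn : ‖x‖ ≠ 0 := norm_ne_zero_iff.2 hx
  have hy' : ‖y‖ = 1 := by rw [norm_eq_coe_normAbs' u, hy, NNReal.coe_one]
  rw [hτ, one_mul, hy', Real.sqrt_one, inv_one, mul_one, ENNReal.toReal_mul, ENNReal.coe_toReal, NNReal.coe_mul, map_inv₀, hy,
    NNReal.coe_inv, NNReal.coe_one, mul_one, ← norm_eq_coe_normAbs' u]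
  push_cast
  rw [← mul_assoc, mul_inv_cancel₀ (Complex.ofReal_ne_zero.2 hxn), one_mul]

end Scalar

section Identity

variable (L : Type) [Field L] [NumberField L] [IsCMField L] (H' : Matrix (Fin 3) (Fin 3) L)
  {v : HeightOneSpectrum (𝓞 ↥(maximalRealSubfield L))} (w : UnitaryGroup.PlacesOver L v) (hw : IsCMField.complexConj L • w.1 ≠ w.1)
  (hH' : (H'.map (IsCMField.complexConj L))ᵀ = H') (hH'u : IsUnit H')
  (hH'i : (isUnit_placeForm H' hH'u w.1).unit ∈ glInt 3 (w.1.adicCompletion L))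
  (μ : HeckeCharacter L) (hdual : HeckeCharacter.galConj (IsCMField.complexConj L) μ = μ⁻¹) (hμ : μ.IsUnramifiedAt w.1)
  [MeasurableSpace ((UnitaryGroup.cmDatum L 3 H').Local v)] [BorelSpace ((UnitaryGroup.cmDatum L 3 H').Local v)]
  [∀ γ : (UnitaryGroup.cmDatum L 3 H').Local v, MeasurableSpace ((UnitaryGroup.cmDatum L 3 H').Local v ⧸ Subgroup.centralizer ({γ} : Set ((UnitaryGroup.cmDatum L 3 H').Local v)))]
  [∀ γ : (UnitaryGroup.cmDatum L 3 H').Local v, BorelSpace ((UnitaryGroup.cmDatum L 3 H').Local v ⧸ Subgroup.centralizer ({γ} : Set ((UnitaryGroup.cmDatum L 3 H').Local v)))]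
  [MeasurableSpace ((UnitaryGroup.cmDatum L 2 (Matrix.of fun i j : Fin 2 => if i.val + j.val + 1 = 2 then (1 : L) else 0)).Local v ×
      (UnitaryGroup.cmDatum L 1 (Matrix.of fun i j : Fin 1 => if i.val + j.val + 1 = 1 then (1 : L) else 0)).Local v)]
  [BorelSpace ((UnitaryGroup.cmDatum L 2 (Matrix.of fun i j : Fin 2 => if i.val + j.val + 1 = 2 then (1 : L) else 0)).Local v ×
      (UnitaryGroup.cmDatum L 1 (Matrix.of fun i j : Fin 1 => if i.val + j.val + 1 = 1 then (1 : L) else 0)).Local v)]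
  [∀ a : ((UnitaryGroup.cmDatum L 2 (Matrix.of fun i j : Fin 2 => if i.val + j.val + 1 = 2 then (1 : L) else 0)).Local v ×
      (UnitaryGroup.cmDatum L 1 (Matrix.of fun i j : Fin 1 => if i.val + j.val + 1 = 1 then (1 : L) else 0)).Local v),
    MeasurableSpace (((UnitaryGroup.cmDatum L 2 (Matrix.of fun i j : Fin 2 => if i.val + j.val + 1 = 2 then (1 : L) else 0)).Local v ×
      (UnitaryGroup.cmDatum L 1 (Matrix.of fun i j : Fin 1 => if i.val + j.val + 1 = 1 then (1 : L) else 0)).Local v) ⧸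
      Subgroup.centralizer ({a} : Set ((UnitaryGroup.cmDatum L 2 (Matrix.of fun i j : Fin 2 => if i.val + j.val + 1 = 2 then (1 : L) else 0)).Local v ×
      (UnitaryGroup.cmDatum L 1 (Matrix.of fun i j : Fin 1 => if i.val + j.val + 1 = 1 then (1 : L) else 0)).Local v)))]
  [∀ a : ((UnitaryGroup.cmDatum L 2 (Matrix.of fun i j : Fin 2 => if i.val + j.val + 1 = 2 then (1 : L) else 0)).Local v ×
      (UnitaryGroup.cmDatum L 1 (Matrix.of fun i j : Fin 1 => if i.val + j.val + 1 = 1 then (1 : L) else 0)).Local v),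
    BorelSpace (((UnitaryGroup.cmDatum L 2 (Matrix.of fun i j : Fin 2 => if i.val + j.val + 1 = 2 then (1 : L) else 0)).Local v ×
      (UnitaryGroup.cmDatum L 1 (Matrix.of fun i j : Fin 1 => if i.val + j.val + 1 = 1 then (1 : L) else 0)).Local v) ⧸
      Subgroup.centralizer ({a} : Set ((UnitaryGroup.cmDatum L 2 (Matrix.of fun i j : Fin 2 => if i.val + j.val + 1 = 2 then (1 : L) else 0)).Local v ×
      (UnitaryGroup.cmDatum L 1 (Matrix.of fun i j : Fin 1 => if i.val + j.val + 1 = 1 then (1 : L) else 0)).Local v)))]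
  (νG : Measure ((UnitaryGroup.cmDatum L 3 H').Local v)) [νG.IsHaarMeasure] [νG.IsMulRightInvariant]
  (hKG : νG (UnitaryGroup.cmLocalIntegralLevel L 3 H' v : Set ((UnitaryGroup.cmDatum L 3 H').Local v)) = 1)
  (νH : Measure ((UnitaryGroup.cmDatum L 2 (Matrix.of fun i j : Fin 2 => if i.val + j.val + 1 = 2 then (1 : L) else 0)).Local v ×
      (UnitaryGroup.cmDatum L 1 (Matrix.of fun i j : Fin 1 => if i.val + j.val + 1 = 1 then (1 : L) else 0)).Local v)) [νH.IsHaarMeasure] [νH.IsMulRightInvariant]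
  (hKH : νH (((UnitaryGroup.cmLocalIntegralLevel L 2 (Matrix.of fun i j : Fin 2 => if i.val + j.val + 1 = 2 then (1 : L) else 0) v).prod
        (UnitaryGroup.cmLocalIntegralLevel L 1 (Matrix.of fun i j : Fin 1 => if i.val + j.val + 1 = 1 then (1 : L) else 0) v) : Subgroup ((UnitaryGroup.cmDatum L 2 (Matrix.of fun i j : Fin 2 => if i.val + j.val + 1 = 2 then (1 : L) else 0)).Local v ×
      (UnitaryGroup.cmDatum L 1 (Matrix.of fun i j : Fin 1 => if i.val + j.val + 1 = 1 then (1 : L) else 0)).Local v)) : Set ((UnitaryGroup.cmDatum L 2 (Matrix.of fun i j : Fin 2 => if i.val + j.val + 1 = 2 then (1 : L) else 0)).Local v ×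
      (UnitaryGroup.cmDatum L 1 (Matrix.of fun i j : Fin 1 => if i.val + j.val + 1 = 1 then (1 : L) else 0)).Local v)) = 1)
  (mH : OrbitalMeasureFamily ((UnitaryGroup.cmDatum L 2 (Matrix.of fun i j : Fin 2 => if i.val + j.val + 1 = 2 then (1 : L) else 0)).Local v ×
      (UnitaryGroup.cmDatum L 1 (Matrix.of fun i j : Fin 1 => if i.val + j.val + 1 = 1 then (1 : L) else 0)).Local v))
  (mG : OrbitalMeasureFamily ((UnitaryGroup.cmDatum L 3 H').Local v))
  (hmH : mH.IsCanonical (IsLocalGRegular L v) νH)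
  (hmG : mG.IsCanonical (fun γ => IsRegularElt (γ.val : GL (Fin 3) (UnitaryGroup.LocalRing L v))) νG)

set_option maxHeartbeats 400000 in
include hw hH' hH'i hdual hμ hKG hKH hmH hmG in
/-- **THE PER-PAIR IDENTITY OF THE UNIT FUNDAMENTAL LEMMA AT A SPLIT PLACE** (Rogawski 1990, Prop. 4.9.1 (b): «`Δ_{G∕H}(γ)Φ^κ(γ, f) = Φ^st(γ, f^H)`
where `f` and `f^H` are the units of the Hecke algebras», at a place `v` of `L⁺` split in `L` where stable conjugacy is conjugacy and `κ = +1`).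
Let `v` split (`w ∣ v`, `c • w ≠ w`), `H′` hermitian, invertible and `w`-unimodular (`H′_w ∈ GL₃(𝒪_w)`), `μᶜ = μ⁻¹`, `μ` UNRAMIFIED at `w`; let `mH`, `mG`
be CANONICAL for `(IsLocalGRegular, νH)`, `(IsRegularElt, νG)` with `νH(K_H) = νG(K′) = 1`.  Then for every `G`-regular `γ_H ∈ H_v` and every match
`γ₀ ∈ U(H′)_v` (★ `IsLocalNormPair`):
`Φ([γ_H], 1_{K_H}; mH) = Δ‴_v(γ_H, γ₀) · Φ([γ₀], 1_{K′}; mG)` for Rogawski's explicit factor (★ `finExplicitCollection`, any invariance families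
`hl`, `hr`).  PROOF: replace `γ₀` by the conjugate normalised match `γ₁` with `e′ γ₁ = diag(e₂ γ_H.1, e₁ γ_H.2) = p ∈ M` (★ B3, ★ B4′; both sides
are class functions); both class orbital integrals are the Levi integral `I_M(p)` (★ FILE A), the `G′`-side with the factor `‖det(1 − K_p)‖⁻¹ ‖det K_p‖`;
`Δ‴_v = μ_w(det g_w) · ‖det(1 − K_p)‖ · ‖det K_p‖^{−1∕2}` (★ D-S2s, ★ B6, ★ D-S2r); off the support of `I_M` both sides vanish, on it
`‖det K_p‖ = 1` and `μ_w(det g_w) = 1` (§1), and the scalars cancel (`unit_scalar_identity`).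
[cite: Rogawski1990, §4.9 Prop. 4.9.1 (b) p. 55; §4.13 Lemma 4.13.1 (a) p. 64; §14.2 p. 232] [cite: DeitmarEchterhoff2014, Thm. 1.5.3] -/
theorem classOrbitalIntegral_unit_eq_finExplicitDelta_mul_of_split
    (hl : ∀ (v' : HeightOneSpectrum (𝓞 ↥(maximalRealSubfield L)))
      (a : ((UnitaryGroup.cmDatum L 2 (Matrix.of fun i j : Fin 2 => if i.val + j.val + 1 = 2 then (1 : L) else 0)).Local v' ×
        (UnitaryGroup.cmDatum L 1 (Matrix.of fun i j : Fin 1 => if i.val + j.val + 1 = 1 then (1 : L) else 0)).Local v'))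
      (b : (UnitaryGroup.cmDatum L 3 H').Local v')
      (x : ((UnitaryGroup.cmDatum L 2 (Matrix.of fun i j : Fin 2 => if i.val + j.val + 1 = 2 then (1 : L) else 0)).Local v' ×
        (UnitaryGroup.cmDatum L 1 (Matrix.of fun i j : Fin 1 => if i.val + j.val + 1 = 1 then (1 : L) else 0)).Local v')),
      finExplicitDelta L v' H' (x * a * x⁻¹) μ b = finExplicitDelta L v' H' a μ b)
    (hr : ∀ (v' : HeightOneSpectrum (𝓞 ↥(maximalRealSubfield L)))
      (a : ((UnitaryGroup.cmDatum L 2 (Matrix.of fun i j : Fin 2 => if i.val + j.val + 1 = 2 then (1 : L) else 0)).Local v' ×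
        (UnitaryGroup.cmDatum L 1 (Matrix.of fun i j : Fin 1 => if i.val + j.val + 1 = 1 then (1 : L) else 0)).Local v'))
      (b y : (UnitaryGroup.cmDatum L 3 H').Local v'),
      finExplicitDelta L v' H' a μ (y * b * y⁻¹) = finExplicitDelta L v' H' a μ b)
    (γH : ((UnitaryGroup.cmDatum L 2 (Matrix.of fun i j : Fin 2 => if i.val + j.val + 1 = 2 then (1 : L) else 0)).Local v ×
      (UnitaryGroup.cmDatum L 1 (Matrix.of fun i j : Fin 1 => if i.val + j.val + 1 = 1 then (1 : L) else 0)).Local v))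
    (hreg : IsLocalGRegular L v γH) (γ₀ : (UnitaryGroup.cmDatum L 3 H').Local v) (h₀ : IsLocalNormPair L H' v γH γ₀) :
    classOrbitalIntegral mH ((((UnitaryGroup.cmLocalIntegralLevel L 2 (Matrix.of fun i j : Fin 2 => if i.val + j.val + 1 = 2 then (1 : L) else 0) v).prod
        (UnitaryGroup.cmLocalIntegralLevel L 1 (Matrix.of fun i j : Fin 1 => if i.val + j.val + 1 = 1 then (1 : L) else 0) v) : Subgroup ((UnitaryGroup.cmDatum L 2 (Matrix.of fun i j : Fin 2 => if i.val + j.val + 1 = 2 then (1 : L) else 0)).Local v ×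
      (UnitaryGroup.cmDatum L 1 (Matrix.of fun i j : Fin 1 => if i.val + j.val + 1 = 1 then (1 : L) else 0)).Local v)) : Set ((UnitaryGroup.cmDatum L 2 (Matrix.of fun i j : Fin 2 => if i.val + j.val + 1 = 2 then (1 : L) else 0)).Local v ×
      (UnitaryGroup.cmDatum L 1 (Matrix.of fun i j : Fin 1 => if i.val + j.val + 1 = 1 then (1 : L) else 0)).Local v)).indicator fun _ => (1 : ℂ)) (ConjClasses.mk γH) =
      (finExplicitCollection L H' μ hl hr v).Δ γH γ₀ *
        classOrbitalIntegral mG ((UnitaryGroup.cmLocalIntegralLevel L 3 H' v : Set ((UnitaryGroup.cmDatum L 3 H').Local v)).indicator fun _ => (1 : ℂ))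
          (ConjClasses.mk γ₀) := by
  -- (0) the GL-side instances at `w`
  letI : MeasurableSpace (w.1.adicCompletion L) := borel _
  haveI : BorelSpace (w.1.adicCompletion L) := ⟨rfl⟩
  letI : MeasurableSpace (GL (Fin 3) (w.1.adicCompletion L)) := borel _
  haveI : BorelSpace (GL (Fin 3) (w.1.adicCompletion L)) := ⟨rfl⟩
  haveI : LocallyCompactSpace (GL (Fin 3) (w.1.adicCompletion L)) := UnitaryGroup.locallyCompactSpace_gl_adicCompletion L 3 w.1
  haveI : SecondCountableTopology (GL (Fin 3) (w.1.adicCompletion L)) := UnitaryGroup.secondCountableTopology_gl_adicCompletion L 3 w.1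
  haveI : LocallyCompactSpace ↥(standardLeviGL (w.1.adicCompletion L) (fun i : Fin 3 => decide (2 ≤ (i : ℕ)))) :=
    (isClosed_standardLeviGL (R := (w.1.adicCompletion L)) (fun i : Fin 3 => decide (2 ≤ (i : ℕ)))).isClosedEmbedding_subtypeVal.locallyCompactSpace
  -- (1) the split isomorphisms, in the (b3) convention
  obtain ⟨e', he'⟩ : ∃ e' : (UnitaryGroup.cmDatum L 3 H').Local v ≃ₜ* GL (Fin 3) (w.1.adicCompletion L),
      e' = localSplitEquiv (IsCMField.complexConj L) H' (IsCMField.complexConj_ne_one L) hH' w hw (isUnit_placeForm H' hH'u w.1) := ⟨_, rfl⟩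
  obtain ⟨e₂, he₂⟩ : ∃ e₂ : (UnitaryGroup.cmDatum L 2 (Matrix.of fun i j : Fin 2 => if i.val + j.val + 1 = 2 then (1 : L) else 0)).Local v ≃ₜ* GL (Fin 2) (w.1.adicCompletion L),
      e₂ = localSplitEquiv (IsCMField.complexConj L) _ (IsCMField.complexConj_ne_one L)
        (antidiagOne_map_transpose (IsCMField.complexConj L) 2) w hw (isUnit_placeForm_antidiagOne 2 w.1) := ⟨_, rfl⟩
  obtain ⟨e₁, he₁⟩ : ∃ e₁ : (UnitaryGroup.cmDatum L 1 (Matrix.of fun i j : Fin 1 => if i.val + j.val + 1 = 1 then (1 : L) else 0)).Local v ≃ₜ* GL (Fin 1) (w.1.adicCompletion L),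
      e₁ = localSplitEquiv (IsCMField.complexConj L) _ (IsCMField.complexConj_ne_one L)
        (antidiagOne_map_transpose (IsCMField.complexConj L) 1) w hw (isUnit_placeForm_antidiagOne 1 w.1) := ⟨_, rfl⟩
  -- (2) the Levi point `p = diag(e₂ γ_H.1, e₁ γ_H.2)` with its block data (★ B4″) and the normalised match `γ₁`
  obtain ⟨m, eI, j₀, hj₀, -, hm, hg, ht⟩ := exists_eq_leviEmbeddingP_blocks 2 (e₂ γH.1) (e₁ γH.2)
  -- `p` in the `Fin 3` spelling of FILE A, DEFINITIONALLY the `leviEmbeddingP … m` of ★ B4″ ∕ ★ D-S2r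
  let p : standardParabolicGL (w.1.adicCompletion L) (fun i : Fin 3 => decide (2 ≤ (i : ℕ))) :=
    leviEmbeddingP (w.1.adicCompletion L) (fun i : Fin (2 + 1) => decide (2 ≤ (i : ℕ))) m
  have hp : (p : GL (Fin 3) (w.1.adicCompletion L)) = UnitaryGroup.reindexGL finSumFinEquiv (UnitaryGroup.blockDiagGL (e₂ γH.1, e₁ γH.2)) := hm
  have hpM : (p : GL (Fin 3) (w.1.adicCompletion L)) ∈ standardLeviGL (w.1.adicCompletion L) (fun i : Fin 3 => decide (2 ≤ (i : ℕ))) := by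
    have h := reindexGL_finSumFinEquiv_blockDiagGL_mem_standardLeviGL (S := (w.1.adicCompletion L)) (e₂ γH.1, e₁ γH.2)
    rw [← hm] at h
    exact h
  have hT : IsClosed ((Subgroup.centralizer ({(p : GL (Fin 3) (w.1.adicCompletion L))} : Set (GL (Fin 3) (w.1.adicCompletion L))) :
      Subgroup (GL (Fin 3) (w.1.adicCompletion L))) : Set (GL (Fin 3) (w.1.adicCompletion L))) := isClosed_coe_centralizer_singleton _
  have hregx : IsRegularElt (UnitaryGroup.reindexGL finSumFinEquiv (UnitaryGroup.blockDiagGL (e₂ γH.1, e₁ γH.2))) := by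
    refine isRegularElt_of_isConj (isConj_endoGL_reindexGL_blockDiagGL (e₂ γH.1, e₁ γH.2)) ?_
    rw [he₂, he₁]
    exact isRegularElt_endoGL_of_isLocalGRegular_of_split L (IsCMField.complexConj_ne_one L) w hw _ _ _ _ γH hreg
  obtain ⟨γ₁, hγ₁⟩ : ∃ γ₁ : (UnitaryGroup.cmDatum L 3 H').Local v, e' γ₁ = UnitaryGroup.reindexGL finSumFinEquiv (UnitaryGroup.blockDiagGL (e₂ γH.1, e₁ γH.2)) :=
    ⟨e'.symm _, e'.apply_symm_apply _⟩
  have hpair₁ : IsLocalNormPair L H' v γH γ₁ := by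
    have h1 : IsConj (endoGL (e₂ γH.1, e₁ γH.2)) (e' γ₁) := by
      rw [hγ₁]; exact isConj_endoGL_reindexGL_blockDiagGL _
    rw [he₂, he₁, he'] at h1
    exact (isLocalNormPair_iff_isConj_endoGL_of_split L H' (IsCMField.complexConj_ne_one L) w hw _ _ _ _ hH'
      (isUnit_placeForm H' hH'u w.1) γH γ₁).2 h1
  have hcl : ConjClasses.mk γ₀ = ConjClasses.mk γ₁ :=
    ConjClasses.mk_eq_mk_iff_isConj.2 (isConj_of_isLocalNormPair_of_split L H' hH' w hw (isUnit_placeForm H' hH'u w.1) h₀ hpair₁)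
  have hreg₁ : IsRegularElt (γ₁.val : GL (Fin 3) (UnitaryGroup.LocalRing L v)) := isRegularElt_of_isLocalNormPair L H' v hpair₁ hreg
  -- (3) `Δ‴_v(γ_H, γ₀) = τ_v(γ_H) · D_{G∕H,v}(γ_H)` and `D_{G∕H,v}` in the box of `p`
  have hu := isUnit_eval_finCharpolyTwo_of_isLocalGRegular L v γH hreg
  have hΔ : (finExplicitCollection L H' μ hl hr v).Δ γH γ₀ = finTau L v γH μ * (finWeylRatio L v γH : ℂ) := by
    rw [finExplicitCollection_Δ]; exact finExplicitDelta_eq_tau_mul_weyl_of_split L v γH w H' hw μ h₀ hu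
  have hg' : Matrix.reindex eI eI ((m false : GL {i : Fin (2 + 1) // decide (2 ≤ (i : ℕ)) = false} (w.1.adicCompletion L)) :
      Matrix {i : Fin (2 + 1) // decide (2 ≤ (i : ℕ)) = false} {i : Fin (2 + 1) // decide (2 ≤ (i : ℕ)) = false} (w.1.adicCompletion L)) =
        (γH.1.val.val : Matrix (Fin 2) (Fin 2) (UnitaryGroup.LocalRing L v)).map (fun x => x w) := by
    rw [hg, he₂]; rfl
  have ht' : ((m true : GL {j : Fin (2 + 1) // decide (2 ≤ (j : ℕ)) = true} (w.1.adicCompletion L)) :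
      Matrix {j : Fin (2 + 1) // decide (2 ≤ (j : ℕ)) = true} {j : Fin (2 + 1) // decide (2 ≤ (j : ℕ)) = true} (w.1.adicCompletion L)) j₀ j₀ =
        finGammaTwo L v γH w := by
    rw [ht, he₁]; rfl
  have hD := finWeylRatio_eq_boxAd_of_split L v γH w m eI j₀ hj₀ hw hg' ht'
  have hpbox := det_one_sub_boxAd_ne_zero_of_det_sub_ne_zero 2 (e₂ γH.1) (e₁ γH.2)
    (det_sub_ne_zero_of_isRegularElt_reindexGL_blockDiagGL 2 finSumFinEquiv (e₂ γH.1) (e₁ γH.2) hregx) p hp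
  -- (4) the canonical Levi measures and the two Levi sides (★ FILE A)
  letI : MeasurableSpace (↥(standardLeviGL (w.1.adicCompletion L) (fun i : Fin 3 => decide (2 ≤ (i : ℕ)))) ⧸ (Subgroup.centralizer ({(p : GL (Fin 3) (w.1.adicCompletion L))} : Set (GL (Fin 3) (w.1.adicCompletion L)))).subgroupOf
      (standardLeviGL (w.1.adicCompletion L) (fun i : Fin 3 => decide (2 ≤ (i : ℕ))))) := borel _
  haveI : BorelSpace (↥(standardLeviGL (w.1.adicCompletion L) (fun i : Fin 3 => decide (2 ≤ (i : ℕ)))) ⧸ (Subgroup.centralizer ({(p : GL (Fin 3) (w.1.adicCompletion L))} : Set (GL (Fin 3) (w.1.adicCompletion L)))).subgroupOf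
      (standardLeviGL (w.1.adicCompletion L) (fun i : Fin 3 => decide (2 ≤ (i : ℕ))))) := ⟨rfl⟩
  have hcan := exists_levi_canonical_measures w (e₂ γH.1) (e₁ γH.2) p hp hregx
  obtain ⟨νM, hνH, hνR, hνI, tM, htH, htI, hνM, htM⟩ := hcan
  haveI := hνH; haveI := hνR; haveI := hνI; haveI := htH; haveI := htI
  have hG := classOrbitalIntegral_unit_eq_weyl_mul_levi_of_split (L := L) (H' := H') (w := w) (hw := hw) (hH' := hH')
    (hH'w := isUnit_placeForm H' hH'u w.1) (g := e₂ γH.1) (u := e₁ γH.2) (p := p) (hp := hp) (hpM := hpM) (hT := hT)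
    (νM := νM) (hνM := hνM) (tM := tM) (htM := htM) hH'i νG hKG mG hmG e' he' γ₁ hreg₁ hγ₁
  have hHside := classOrbitalIntegral_unit_eq_levi_of_split_H (L := L) (w := w) (hw := hw) (p := p) (hpM := hpM) (hT := hT)
    (νM := νM) (hνM := hνM) (tM := tM) (htM := htM) νH hKH mH hmH e₂ he₂ e₁ he₁ γH hreg hp
  rw [hHside, hcl, hG, hΔ, hD]
  -- (5) the support rule and the scalar bookkeeping
  refine unit_scalar_identity w.1 _ _ hpbox _ _ fun hI => ?_
  obtain ⟨m₀, hm₀⟩ := exists_conj_apply_mem_of_lintegral_descConj_indicator_ne_zero _ _ _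
    (fun m' : ↥(standardLeviGL (w.1.adicCompletion L) (fun i : Fin 3 => decide (2 ≤ (i : ℕ)))) => (m' : GL (Fin 3) (w.1.adicCompletion L))) _ hI
  refine ⟨normAbs_det_boxAd_eq_one_of_conj_mem_glInt w p hpM m₀ hm₀, finTau_eq_one_of_isUnramifiedAt L v γH w μ hw hdual hμ hu ?_⟩
  refine valued_eq_one_of_normAbs_eq_one w.1 _ ?_
  rw [IsUnit.unit_spec]
  have hdet : ((γH.1.val.val : Matrix (Fin 2) (Fin 2) (UnitaryGroup.LocalRing L v)).map (fun x => x w)).det =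
      ((e₂ γH.1 : GL (Fin 2) (w.1.adicCompletion L)) : Matrix (Fin 2) (Fin 2) (w.1.adicCompletion L)).det := by
    rw [he₂]; rfl
  rw [hdet]
  exact normAbs_det_fst_eq_one_of_conj_mem_glInt w (e₂ γH.1) (e₁ γH.2) p hp hpM m₀ hm₀

/-! ## §3 The letter's local clause at a split place -/

include hw hH' hH'i hdual hμ hKG hKH hmH hmG in
/-- **N7 AT A SPLIT PLACE**: under the guards of `classOrbitalIntegral_unit_eq_finExplicitDelta_mul_of_split` (place `v` of `L⁺` split in `L`, `H′`
hermitian invertible and `w`-unimodular, `μᶜ = μ⁻¹`, `μ` unramified at `w`, CANONICAL `mH`, `mG` with levels of mass one) the letter's local clause holds: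
`IsLocalUnitTransfer L H′ v (finExplicitCollection L H′ μ hl hr v) mH mG` — `1_{K_H}` is a `Δ‴_v`-transfer of `1_{K′}` (★ p838654
`isLocalUnitTransfer_of_forall_isLocalNormPair_of_split` + §2).  This is the SPLIT half of ★ `UnitFundamentalLemmaExplicit`'s
`∃ Sbad, ∀ v ∉ Sbad, …` (the bad set containing the ramified places of `μ` and the places where `H′` is not `w`-unimodular); the non-split half is
[BlasiusRogawski1992] and is not touched here. [cite: Rogawski1990, §4.9 Prop. 4.9.1 (b) p. 55; §14.2 p. 232] -/
theorem isLocalUnitTransfer_finExplicitCollection_of_split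
    (hl : ∀ (v' : HeightOneSpectrum (𝓞 ↥(maximalRealSubfield L)))
      (a : ((UnitaryGroup.cmDatum L 2 (Matrix.of fun i j : Fin 2 => if i.val + j.val + 1 = 2 then (1 : L) else 0)).Local v' ×
        (UnitaryGroup.cmDatum L 1 (Matrix.of fun i j : Fin 1 => if i.val + j.val + 1 = 1 then (1 : L) else 0)).Local v'))
      (b : (UnitaryGroup.cmDatum L 3 H').Local v')
      (x : ((UnitaryGroup.cmDatum L 2 (Matrix.of fun i j : Fin 2 => if i.val + j.val + 1 = 2 then (1 : L) else 0)).Local v' ×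
        (UnitaryGroup.cmDatum L 1 (Matrix.of fun i j : Fin 1 => if i.val + j.val + 1 = 1 then (1 : L) else 0)).Local v')),
      finExplicitDelta L v' H' (x * a * x⁻¹) μ b = finExplicitDelta L v' H' a μ b)
    (hr : ∀ (v' : HeightOneSpectrum (𝓞 ↥(maximalRealSubfield L)))
      (a : ((UnitaryGroup.cmDatum L 2 (Matrix.of fun i j : Fin 2 => if i.val + j.val + 1 = 2 then (1 : L) else 0)).Local v' ×
        (UnitaryGroup.cmDatum L 1 (Matrix.of fun i j : Fin 1 => if i.val + j.val + 1 = 1 then (1 : L) else 0)).Local v'))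
      (b y : (UnitaryGroup.cmDatum L 3 H').Local v'),
      finExplicitDelta L v' H' a μ (y * b * y⁻¹) = finExplicitDelta L v' H' a μ b) :
    IsLocalUnitTransfer L H' v (finExplicitCollection L H' μ hl hr v) mH mG :=
  isLocalUnitTransfer_of_forall_isLocalNormPair_of_split L H' (IsCMField.complexConj_ne_one L) w hw
    (antidiagOne_map_transpose (IsCMField.complexConj L) 2) (isUnit_placeForm_antidiagOne 2 w.1) (isUnit_antidiagOne_det L 2).ne_zero
    (antidiagOne_map_transpose (IsCMField.complexConj L) 1) (isUnit_placeForm_antidiagOne 1 w.1) (isUnit_antidiagOne_det L 1).ne_zero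
    hH' (isUnit_placeForm H' hH'u w.1) _ mH mG
    fun γH hreg γ₀ h₀ =>
      classOrbitalIntegral_unit_eq_finExplicitDelta_mul_of_split L H' w hw hH' hH'u hH'i μ hdual hμ νG hKG νH hKH mH mG hmH hmG hl hr
        γH hreg γ₀ h₀

end Identity

end Literature.NumberTheory.Rogawski1990

end
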